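import Summits.Ventures.DiscreteObjects.Hadamard.QRBlocks167
import Literature.Combinatorics.Designs.LegendrePairs.TwoCirculantCore

/-!
# Hadamard 668 census — the (+) control of the Legendre-pair family at the prime 167, certified in the kernel

Framing: lottery ticket; floor = certified bounds/negative ranges.

Cell pub-namedobj (venture DiscreteObjects), target (H).  The classical Paley-type Legendre pair of prime length
`p ≡ 3 (mod 4)`: `a = b = χ'` with `χ'(0) = 1` and `χ'(i) = (i/p)` the Legendre symbol — here at `p = 167`, written with
the square table of `QRBlocks167` as the block `blk 1 1 (-1)` (value `1` at `0` and on the squares, `-1` on the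
non-squares).  `PAF_{χ'}(s) = -1` for every `s ≠ 0`, so `(χ', χ')` is a Legendre pair of length 167
(`paley_legendrePair167`, all 166 shifts by `decide`), and the formalised Fletcher–Gysin–Seberry plug-in
(`exists_hadamard_of_legendrePair`, Literature/…/LegendrePairs/TwoCirculantCore) yields a kernel-certified Hadamard
matrix of order `336 = 2·167 + 2` (`hadamard336_paley`).  This is the family-F5 pipeline's (+) control run end-to-end in
the kernel at the census prime; the open target is the same statement at length `333` (order 668).
Ours (certificate of a classical object); no `sorry`, no `native_decide`.
-/

open Matrix

namespace Summit.Ventures.DiscreteObjects.Hadamard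

open Literature.Combinatorics.Designs.LegendrePairs (PAF IsPM LegendrePair CoreIdx exists_hadamard_of_legendrePair
  card_coreIdx)

/-- the Paley sequence `χ'` on `ZMod 167`: `1` at `0` and on the non-zero squares, `-1` on the non-squares -/
def paley167 : ZMod 167 → ℤ := blk 1 1 (-1)

/-- `χ'` is `±1`-valued -/
lemma isPM_paley167 : IsPM paley167 := fun i => by
  unfold paley167 blk; split_ifs <;> simp

set_option maxRecDepth 100000 in
set_option maxHeartbeats 40000000 in
/-- `PAF_{χ'}(s) + PAF_{χ'}(s) = -2` at every non-zero shift (kernel evaluation over `ZMod 167`) -/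
theorem paley167_paf : ∀ s : ZMod 167, s ≠ 0 → PAF paley167 s + PAF paley167 s = -2 := by
  decide

/-- **(χ', χ') is a Legendre pair of length 167** (Paley type). -/
theorem paley_legendrePair167 : LegendrePair paley167 paley167 :=
  ⟨isPM_paley167, isPM_paley167, paley167_paf⟩

/-- **H(336) certified**: through the two-circulant-core plug-in the Paley pair gives a `±1` matrix `H` of order
`336 = |CoreIdx 167|` with `H Hᵀ = 336·I`. -/
theorem hadamard336_paley :
    (∃ H : Matrix (CoreIdx 167) (CoreIdx 167) ℤ,
      (∀ x y, H x y = 1 ∨ H x y = -1) ∧ H * Hᵀ = (336 : ℤ) • (1 : Matrix (CoreIdx 167) (CoreIdx 167) ℤ)) ∧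
    Fintype.card (CoreIdx 167) = 336 := by
  refine ⟨?_, by rw [card_coreIdx]⟩
  obtain ⟨H, h1, h2⟩ := exists_hadamard_of_legendrePair _ _ paley_legendrePair167
  exact ⟨H, h1, by rw [h2]; norm_num⟩

end Summit.Ventures.DiscreteObjects.Hadamard
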